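import Literature.MeasureTheory.Hausdorff.SphereAreaGeneral
import Mathlib.Geometry.Euclidean.Volume.Measure
import Mathlib.MeasureTheory.Measure.Haar.InnerProductSpace
import Mathlib.MeasureTheory.Measure.Lebesgue.VolumeOfBalls
import HarnessLib

/-!
# Mathlib's Hausdorff measure dominates Lebesgue measure: `volume ≤ μH[d]`, `μHE[d] ≤ μH[d]`,
# and lower bounds for the `μH[d]`-measure of spherical caps in chordal balls

Mathlib's Hausdorff measure `μH[d]` is the un-normalised Carathéodory construction
`μH[d] s = sup_{δ} inf {∑ (diam tᵢ)^d}` (no factor `ω_d / 2^d`), and its Euclidean Hausdorff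
measure is `μHE[d] = a_d • μH[d]` with `a_d = addHaarScalarFactor volume μH[d]` computed on
`EuclideanSpace ℝ (Fin d)`, so that `μHE[d] = volume` on every `d`-dimensional real inner product
space.  The value `a_d = ω_d / 2^d` is the isodiametric inequality and is only a `proof_wanted` in
Mathlib.  This file proves the cheap half, which is all that LOWER bounds need:

* `volume_le_hausdorffMeasure`: `volume s ≤ μH[d] s` on `EuclideanSpace ℝ (Fin d)` — the
  coordinate map `ℓ² → ℓ^∞` is `1`-Lipschitz and measure preserving, and `μH[d] = volume` for the
  sup metric (Mathlib's `hausdorffMeasure_pi_real`);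
* `addHaarScalarFactor_volume_hausdorffMeasure_le_one`: hence `a_d ≤ 1`;
* `euclideanHausdorffMeasure_le_hausdorffMeasure`, `euclideanHausdorffMeasure_apply_le`:
  **`μHE[d] ≤ μH[d]`** on every emetric Borel space, and `volume_le_hausdorffMeasure_finrank`,
  `volume_le_hausdorffMeasure_of_finrank_eq`: `volume ≤ μH[dim V]` on every finite-dimensional real
  inner product space `V`;
* `unitSphere_inter_ball_eq_cap`: the trace `{‖y‖ = 1} ∩ B(x, r)` of a CHORDAL ball centred on the
  unit sphere is the cap `cap x (1 - r²/2)` of `SphericalCap.lean`;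
* `le_hausdorffMeasure_cap`, `le_euclideanHausdorffMeasure_unitSphere_inter_ball`,
  `le_hausdorffMeasure_unitSphere_inter_ball`: in dimension `d + 1`,
  `ω_d ρ^d ≤ μHE[d] (S^d ∩ B(x, r)) ≤ μH[d] (S^d ∩ B(x, r))` with `ρ² = r² - r⁴/4` (`0 < r`,
  `r² < 2`), from the tree's `le_euclideanHausdorffMeasure_cap_general` (`1`-Lipschitz projection
  onto `x^⊥`);
* `le_hausdorffMeasure_sphere_inter_ball`: the unit `S⁴ ⊂ ℝ⁵` has
  `9π²/32 · r⁴ ≤ μH[4] (S⁴ ∩ B(x, r))` for `0 < r ≤ 1` (`ω_4 = π²/2`, `ρ² ≥ 3r²/4`);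
* `hausdorffMeasure_range_inter_ball_of_isometry`
  (`μH[d] (range f ∩ B(f x, r)) = μH[d] (S ∩ B(x, r))` for an isometry `f : S → X`),
  `le_hausdorffMeasure_range_inter_ball_of_isometry`: the same numbers for every isometric copy
  `range f` of `S⁴` (e.g. the slices `S⁴ × {c}` of the round cylinder in `ℝ⁶`), in the spelling
  `μH[4] (range f ∩ ball (f x) r)`.

NOT here: the equality `a_d = ω_d / 2^d` (isodiametric inequality, Federer 2.10.35), upper bounds
for `μH[d]` of caps (they need that equality or a covering argument), geodesic balls.

## References

* H. Federer, *Geometric measure theory* (1969), 2.10.2, 2.10.11, 2.10.35.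
* P. Mattila, *Geometry of sets and measures in Euclidean spaces* (1995), §4.3, Thm. 3.4, 7.
-/

noncomputable section

open Set Metric Module Submodule
open _root_.MeasureTheory _root_.MeasureTheory.Measure
open scoped ENNReal NNReal Topology RealInnerProductSpace

namespace Literature.MeasureTheory.Hausdorff

/-! ### `volume ≤ μH[d]` on the model space and the normalising factor `a_d ≤ 1` -/

/-- **Lebesgue measure is dominated by Mathlib's un-normalised Hausdorff measure** on
`EuclideanSpace ℝ (Fin d)`: `volume s ≤ μH[d] s`.  The coordinate map `ℓ² → ℓ^∞` is `1`-Lipschitz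
(so it does not increase `μH[d]`) and measure preserving, and on `Fin d → ℝ` (sup metric)
`μH[d] = volume` (Mathlib's `hausdorffMeasure_pi_real`).  Federer 1969, 2.10.2; Mattila 1995, §4.3.
[folklore] -/
theorem volume_le_hausdorffMeasure (d : ℕ) (s : Set (EuclideanSpace ℝ (Fin d))) :
    volume s ≤ μH[d] s := by
  set e : EuclideanSpace ℝ (Fin d) ≃ᵐ (Fin d → ℝ) := (MeasurableEquiv.toLp 2 (Fin d → ℝ)).symm
    with he
  have hmp : MeasurePreserving e volume volume :=
    EuclideanSpace.volume_preserving_symm_measurableEquiv_toLp (Fin d)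
  have h1 : volume s = volume (e '' s) := by
    rw [MeasurableEquiv.image_eq_preimage_symm, hmp.symm.measure_preimage_equiv]
  have h2 : (volume : Measure (Fin d → ℝ)) = μH[d] := by
    have h := (hausdorffMeasure_pi_real (ι := Fin d)).symm
    rwa [Fintype.card_fin] at h
  have hL : LipschitzWith 1 e := by
    rw [he, MeasurableEquiv.coe_toLp_symm]
    exact PiLp.lipschitzWith_ofLp 2 _
  have h3 := hL.hausdorffMeasure_image_le (d := (d : ℝ)) (Nat.cast_nonneg d) s
  rw [ENNReal.coe_one, ENNReal.one_rpow, one_mul] at h3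
  calc volume s = volume (e '' s) := h1
    _ = μH[d] (e '' s) := by rw [h2]
    _ ≤ μH[d] s := h3

/-- **Mathlib's Euclidean normalising factor is at most `1`**: the scalar `a_d` with
`volume = a_d • μH[d]` on `EuclideanSpace ℝ (Fin d)` (the one defining `μHE[d] = a_d • μH[d]`)
satisfies `a_d ≤ 1` (classically `a_d = ω_d / 2^d`, the isodiametric inequality, a `proof_wanted` in
Mathlib; `≤ 1` is `volume (B) ≤ μH[d] (B)` for the unit ball).  Federer 1969, 2.10.35. [folklore] -/
theorem addHaarScalarFactor_volume_hausdorffMeasure_le_one (d : ℕ) :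
    addHaarScalarFactor (volume : Measure (EuclideanSpace ℝ (Fin d))) μH[d] ≤ 1 := by
  set a := addHaarScalarFactor (volume : Measure (EuclideanSpace ℝ (Fin d))) μH[d]
  have h := isAddLeftInvariant_eq_smul (volume : Measure (EuclideanSpace ℝ (Fin d))) μH[d]
  have hb : volume (ball (0 : EuclideanSpace ℝ (Fin d)) 1) =
      (a : ℝ≥0∞) * μH[d] (ball (0 : EuclideanSpace ℝ (Fin d)) 1) := by
    have := congrArg (fun μ : Measure (EuclideanSpace ℝ (Fin d)) => μ (ball 0 1)) h
    simpa only [Measure.smul_apply, ENNReal.smul_def, smul_eq_mul] using this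
  have hle := volume_le_hausdorffMeasure d (ball (0 : EuclideanSpace ℝ (Fin d)) 1)
  rw [hb] at hle
  have h0 : μH[d] (ball (0 : EuclideanSpace ℝ (Fin d)) 1) ≠ 0 :=
    (isOpen_ball.measure_pos _ ⟨0, mem_ball_self one_pos⟩).ne'
  have htop : μH[d] (ball (0 : EuclideanSpace ℝ (Fin d)) 1) ≠ ⊤ := measure_ball_lt_top.ne
  have h1 : (a : ℝ≥0∞) ≤ 1 := (ENNReal.mul_le_mul_iff_left h0 htop).1 (by rwa [one_mul])
  exact_mod_cast h1

/-! ### `μHE[d] ≤ μH[d]` on every emetric space, `volume ≤ μH[dim V]` on inner product spaces -/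

section EMetric

variable {X : Type*} [EMetricSpace X] [MeasurableSpace X] [BorelSpace X]

/-- **`μHE[d] s ≤ μH[d] s`** for every set of every (e)metric Borel space: the Euclidean Hausdorff
measure is the multiple `a_d • μH[d]` with `a_d ≤ 1`.  So LOWER bounds computed with Lebesgue
measure / `μHE` are lower bounds for Mathlib's `μH`. [folklore] -/
theorem euclideanHausdorffMeasure_apply_le (d : ℕ) (s : Set X) :
    (μHE[d] : Measure X) s ≤ μH[d] s := by
  rw [euclideanHausdorffMeasure_def, Measure.smul_apply, ENNReal.smul_def, smul_eq_mul]
  calc _ ≤ (1 : ℝ≥0∞) * μH[d] s := by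
        gcongr
        exact_mod_cast addHaarScalarFactor_volume_hausdorffMeasure_le_one d
    _ = μH[d] s := one_mul _

/-- **`μHE[d] ≤ μH[d]`** as measures, on every (e)metric Borel space. [folklore] -/
theorem euclideanHausdorffMeasure_le_hausdorffMeasure (d : ℕ) :
    (μHE[d] : Measure X) ≤ μH[d] :=
  Measure.le_iff'.2 (euclideanHausdorffMeasure_apply_le d)

end EMetric

section InnerProduct

variable {V : Type*} [NormedAddCommGroup V] [InnerProductSpace ℝ V] [FiniteDimensional ℝ V]
  [MeasurableSpace V] [BorelSpace V]

/-- **`volume ≤ μH[dim V]` on every finite-dimensional real inner product space**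
(`volume = μHE[dim V]` there, Mathlib's `InnerProductSpace.euclideanHausdorffMeasure_eq_volume`, and
`μHE ≤ μH`). [folklore] -/
theorem volume_le_hausdorffMeasure_finrank : (volume : Measure V) ≤ μH[finrank ℝ V] := by
  rw [← InnerProductSpace.euclideanHausdorffMeasure_eq_volume (V := V)]
  exact euclideanHausdorffMeasure_le_hausdorffMeasure (finrank ℝ V)

/-- **`volume s ≤ μH[d] s` on every `d`-dimensional real inner product space.** [folklore] -/
theorem volume_le_hausdorffMeasure_of_finrank_eq {d : ℕ} (hV : finrank ℝ V = d) (s : Set V) :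
    volume s ≤ μH[d] s := by
  rw [← hV]
  exact volume_le_hausdorffMeasure_finrank s

end InnerProduct

/-! ### Spherical caps in chordal balls -/

section Cap

variable {E : Type*} [NormedAddCommGroup E] [InnerProductSpace ℝ E]

/-- **The trace of a chordal ball on the unit sphere is a cap**: for `‖x‖ = 1` and `0 < r`,
`{‖y‖ = 1} ∩ B(x, r) = cap x (1 - r²/2) = {‖y‖ = 1, ⟪x, y⟫ > 1 - r²/2}`
(`‖y - x‖² = 2 - 2⟪x, y⟫` on the unit sphere). [folklore] -/
theorem unitSphere_inter_ball_eq_cap {x : E} (hx : ‖x‖ = 1) {r : ℝ} (hr : 0 < r) :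
    sphere (0 : E) 1 ∩ ball x r = cap x (1 - r ^ 2 / 2) := by
  ext y
  simp only [mem_inter_iff, mem_sphere_zero_iff_norm, mem_ball, dist_eq_norm, cap, mem_setOf_eq]
  refine ⟨fun ⟨hy1, hyr⟩ => ⟨hy1, ?_⟩, fun ⟨hy1, hyc⟩ => ⟨hy1, ?_⟩⟩
  · have hsq : ‖y - x‖ ^ 2 < r ^ 2 := pow_lt_pow_left₀ hyr (norm_nonneg _) two_ne_zero
    rw [norm_sub_sq_real, hy1, hx, real_inner_comm] at hsq
    linarith
  · have hsq : ‖y - x‖ ^ 2 < r ^ 2 := by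
      rw [norm_sub_sq_real, hy1, hx, real_inner_comm]
      linarith
    exact lt_of_pow_lt_pow_left₀ 2 hr.le hsq

variable [MeasurableSpace E] [BorelSpace E] {v : E}

/-- **Lower bound for the un-normalised `μH[d]` of a cap** (any dimension `d ≥ 1`): the cap of
height `c > 0` around a unit vector `v` with `dim v^⊥ = d` has
`ω_d ρ^d ≤ μH[d] (cap v c)`, `ρ = √(1 - c²)`, `ω_d = π^{d/2} / Γ(d/2 + 1)` (the tree's
`le_euclideanHausdorffMeasure_cap_general` for `μHE[d]`, and `μHE[d] ≤ μH[d]`). [folklore] -/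
theorem le_hausdorffMeasure_cap (hv : ‖v‖ = 1) {d : ℕ} (hK : finrank ℝ (ℝ ∙ v)ᗮ = d) (hd : 0 < d)
    [FiniteDimensional ℝ (ℝ ∙ v)ᗮ] {c : ℝ} (hc0 : 0 < c) :
    ENNReal.ofReal (Real.sqrt (1 - c ^ 2)) ^ d *
        ENNReal.ofReal (Real.sqrt Real.pi ^ d / Real.Gamma ((d : ℝ) / 2 + 1)) ≤
      μH[d] (cap v c) :=
  (le_euclideanHausdorffMeasure_cap_general hv hK hd hc0).trans
    (euclideanHausdorffMeasure_apply_le d _)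

variable [FiniteDimensional ℝ E]

/-- **Caps of the unit sphere in chordal balls are fat, `μHE` version**: in a `(d+1)`-dimensional
real inner product space (`d ≥ 1`), for `‖x‖ = 1`, `0 < r`, `r² < 2`,
`ω_d ρ^d ≤ μHE[d] ({‖y‖ = 1} ∩ B(x, r))` with `ρ² = r² - r⁴/4` (the radius of the disc in `x^⊥` onto
which the cap `{⟪x, y⟫ > 1 - r²/2}` projects `1`-Lipschitz). [folklore] -/
theorem le_euclideanHausdorffMeasure_unitSphere_inter_ball {d : ℕ} (hE : finrank ℝ E = d + 1)
    (hd : 0 < d) {x : E} (hx : ‖x‖ = 1) {r : ℝ} (hr : 0 < r) (hr2 : r ^ 2 < 2) :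
    ENNReal.ofReal (Real.sqrt (r ^ 2 - r ^ 4 / 4)) ^ d *
        ENNReal.ofReal (Real.sqrt Real.pi ^ d / Real.Gamma ((d : ℝ) / 2 + 1)) ≤
      (μHE[d] : Measure E) (sphere (0 : E) 1 ∩ ball x r) := by
  haveI : Fact (finrank ℝ E = d + 1) := ⟨hE⟩
  have hx0 : x ≠ 0 := fun h => by simp [h] at hx
  have hK : finrank ℝ (ℝ ∙ x)ᗮ = d := finrank_orthogonal_span_singleton hx0
  have hc0 : 0 < 1 - r ^ 2 / 2 := by linarith
  have hρ : r ^ 2 - r ^ 4 / 4 = 1 - (1 - r ^ 2 / 2) ^ 2 := by ring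
  rw [unitSphere_inter_ball_eq_cap hx hr, hρ]
  exact le_euclideanHausdorffMeasure_cap_general hx hK hd hc0

/-- **Caps of the unit sphere in chordal balls are fat, `μH` version**: in a `(d+1)`-dimensional
real inner product space (`d ≥ 1`), for `‖x‖ = 1`, `0 < r`, `r² < 2`,
`ω_d ρ^d ≤ μH[d] ({‖y‖ = 1} ∩ B(x, r))` with `ρ² = r² - r⁴/4`. [folklore] -/
theorem le_hausdorffMeasure_unitSphere_inter_ball {d : ℕ} (hE : finrank ℝ E = d + 1) (hd : 0 < d)
    {x : E} (hx : ‖x‖ = 1) {r : ℝ} (hr : 0 < r) (hr2 : r ^ 2 < 2) :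
    ENNReal.ofReal (Real.sqrt (r ^ 2 - r ^ 4 / 4)) ^ d *
        ENNReal.ofReal (Real.sqrt Real.pi ^ d / Real.Gamma ((d : ℝ) / 2 + 1)) ≤
      μH[d] (sphere (0 : E) 1 ∩ ball x r) :=
  (le_euclideanHausdorffMeasure_unitSphere_inter_ball hE hd hx hr hr2).trans
    (euclideanHausdorffMeasure_apply_le d _)

end Cap

/-! ### The unit `4`-sphere of `ℝ⁵`: `μH[4] (S⁴ ∩ B(x, r)) ≥ (9π²/32) r⁴` -/

/-- **Lower bound for the `μH[4]`-measure of a chordal cap of the unit `4`-sphere of `ℝ⁵`**: for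
`‖x‖ = 1` and `0 < r ≤ 1`, `ENNReal.ofReal (9π²/32 · r⁴) ≤ μH[4] (S⁴ ∩ B(x, r))`
(`le_hausdorffMeasure_unitSphere_inter_ball` with `d = 4`: `ω_4 = π²/2` and
`ρ⁴ = (r² - r⁴/4)² ≥ (3r²/4)² = 9r⁴/16` for `r ≤ 1`).  This is the static model of the lower
area-density bound of `ε`-regularity for thin flows in `S⁴ × ℝ`. [folklore] -/
theorem le_hausdorffMeasure_sphere_inter_ball {x : EuclideanSpace ℝ (Fin 5)} (hx : ‖x‖ = 1) {r : ℝ}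
    (hr : 0 < r) (hr1 : r ≤ 1) :
    ENNReal.ofReal (9 * Real.pi ^ 2 / 32 * r ^ 4) ≤
      μH[4] (sphere (0 : EuclideanSpace ℝ (Fin 5)) 1 ∩ ball x r) := by
  have hr2 : r ^ 2 ≤ 1 := pow_le_one₀ hr.le hr1
  have h := le_hausdorffMeasure_unitSphere_inter_ball (E := EuclideanSpace ℝ (Fin 5)) (d := 4)
    finrank_euclideanSpace_fin (by norm_num) hx hr (by linarith)
  refine le_trans ?_ (by exact_mod_cast h)
  have hρ0 : 0 ≤ r ^ 2 - r ^ 4 / 4 := by nlinarith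
  have hΓ : Real.Gamma ((4 : ℝ) / 2 + 1) = 2 := by
    rw [show ((4 : ℝ) / 2 + 1) = (2 : ℕ) + 1 by norm_num, Real.Gamma_nat_eq_factorial]
    norm_num [Nat.factorial]
  have hπ : Real.sqrt Real.pi ^ 4 = Real.pi ^ 2 := by
    rw [show Real.sqrt Real.pi ^ 4 = (Real.sqrt Real.pi ^ 2) ^ 2 by ring,
      Real.sq_sqrt Real.pi_pos.le]
  have hρ4 : Real.sqrt (r ^ 2 - r ^ 4 / 4) ^ 4 = (r ^ 2 - r ^ 4 / 4) ^ 2 := by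
    rw [show Real.sqrt (r ^ 2 - r ^ 4 / 4) ^ 4 = (Real.sqrt (r ^ 2 - r ^ 4 / 4) ^ 2) ^ 2 by ring,
      Real.sq_sqrt hρ0]
  rw [hΓ, hπ, ← ENNReal.ofReal_pow (Real.sqrt_nonneg _), hρ4, ← ENNReal.ofReal_mul (sq_nonneg _)]
  apply ENNReal.ofReal_le_ofReal
  have h1 : 3 / 4 * r ^ 2 ≤ r ^ 2 - r ^ 4 / 4 := by nlinarith
  have h2 : (3 / 4 * r ^ 2) ^ 2 ≤ (r ^ 2 - r ^ 4 / 4) ^ 2 := pow_le_pow_left₀ (by positivity) h1 2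
  nlinarith [Real.pi_pos]

/-! ### Isometric copies of a sphere (e.g. the slices `S⁴ × {c} ⊂ ℝ⁶`) -/

section Isometry

variable {E : Type*} [MetricSpace E] [MeasurableSpace E] [BorelSpace E] {S : Set E}
  {X : Type*} [MetricSpace X] [MeasurableSpace X] [BorelSpace X]

/-- **Isometric transport of ball traces**: for an isometry `f : S → X` of a subset `S` of a metric
space `E` into a metric space `X` and `x ∈ S`, `μH[d] (range f ∩ B(f x, r)) = μH[d] (S ∩ B(x, r))`
(`range f ∩ B(f x, r) = f '' B_S(x, r)`, isometries preserve `μH[d]`, and the ball `B_S(x, r)` of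
the subspace `S` is the trace on `S` of the ball of `E`). [folklore] -/
theorem hausdorffMeasure_range_inter_ball_of_isometry {f : S → X} (hf : Isometry f) {d : ℝ}
    (hd : 0 ≤ d) (x : S) (r : ℝ) :
    μH[d] (range f ∩ ball (f x) r) = μH[d] (S ∩ ball (x : E) r) := by
  have himage : range f ∩ ball (f x) r = f '' ball x r := by
    ext z
    constructor
    · rintro ⟨⟨y, rfl⟩, hy⟩
      refine ⟨y, ?_, rfl⟩
      rwa [mem_ball, ← hf.dist_eq]
    · rintro ⟨y, hy, rfl⟩
      refine ⟨⟨y, rfl⟩, ?_⟩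
      rwa [mem_ball, hf.dist_eq]
  have hval : (Subtype.val : S → E) '' ball x r = S ∩ ball (x : E) r := by
    rw [show ball x r = (Subtype.val : S → E) ⁻¹' ball (x : E) r from rfl,
      Subtype.image_preimage_coe]
  rw [himage, hf.hausdorffMeasure_image (Or.inl hd), ← hval,
    (isometry_subtype_coe (s := S)).hausdorffMeasure_image (Or.inl hd)]

end Isometry

/-- **The `S⁴` cap bound for every isometric copy of `S⁴`** (e.g. every slice `S⁴ × {c}` of the
round cylinder `S⁴ × ℝ ⊂ ℝ⁶`, along `x ↦ (x, c)`): for an isometry `f` of the unit sphere of `ℝ⁵`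
into a metric space, `x ∈ S⁴` and `0 < r ≤ 1`,
`ENNReal.ofReal (9π²/32 · r⁴) ≤ μH[4] (range f ∩ B(f x, r))`. [folklore] -/
theorem le_hausdorffMeasure_range_inter_ball_of_isometry {X : Type*} [MetricSpace X]
    [MeasurableSpace X] [BorelSpace X] {f : sphere (0 : EuclideanSpace ℝ (Fin 5)) 1 → X}
    (hf : Isometry f) (x : sphere (0 : EuclideanSpace ℝ (Fin 5)) 1) {r : ℝ} (hr : 0 < r)
    (hr1 : r ≤ 1) :
    ENNReal.ofReal (9 * Real.pi ^ 2 / 32 * r ^ 4) ≤ μH[4] (range f ∩ ball (f x) r) := by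
  rw [hausdorffMeasure_range_inter_ball_of_isometry hf (by norm_num) x r]
  exact le_hausdorffMeasure_sphere_inter_ball (mem_sphere_zero_iff_norm.mp x.2) hr hr1

end Literature.MeasureTheory.Hausdorff

end
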